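import Summits.BirchSwinnertonDyer.BirchSwinnertonDyer.Theorems.ManinLocalTwoThreeManinPrimeToAdditiveFiveLeRedFiveSevenSharpSplit
import Summits.BirchSwinnertonDyer.Rank1Residual.Additive.GordIsogenyInvarianceClasses
import Summits.BirchSwinnertonDyer.Rank1Residual.Additive.TypeGIntegralJ
import Literature.NumberTheory.EllipticCurves.IsogenyPotentiallyGoodOrdinaryMinimalDiscriminant
import HarnessLib

/-!
# Route `ManinLocalTwoThree`, residual crux C5 `ManinPrimeToAdditiveFiveLe`
# (stmt-BirchSwinnertonDyer-22969), line `upper_anchor` (skeleton v6, registered stub `stub_red57bistarred`):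
# **the «bi-starred orbit» corner at `p ∈ {5, 7}` is potentially SUPERSINGULAR — its (G)-ordinary half is
# empty by Dokchitser–Dokchitser 2015**

Width seat bsd-line-ml23-c5-p1-w2 (gen 3), piece λ (HOME STATUS 2026-08-28 after the lead's gen-3 DONE
09:05:45Z; line-first: the registered stub `stub_red57bistarred` of `Cruxes/ManinPrimeToAdditiveFiveLe/Lines/
upper_anchor.lean` v6, sha16 792ced1148944399 = hypothesis `hB` of `coreRED57sharp_of_cns_of_unstarred_of_bistarred`,
p617914). That stub is RED(57♯) on STARRED `W` (`4 < ord_p Δ_min(W)`, Kodaira IV*/III*/II*) under the clause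
«every lattice-optimal globally minimal `W₀ ∼ W ⊗ χ_{p*}` is starred too».

* §1 `red57bistarred_of_dokchitser_of_nonGordCorner` — **the stub ⟸ Dokchitser–Dokchitser 2015 Thm. 5.1 (1)
  (tree cite-only fact `dokchitser_padicValInt_minimalDiscriminantInt_eq_of_isogeny_of_potentiallyGoodOrdinary`:
  an isogeny preserves `ord_p Δ_min` at a potentially good ORDINARY `p`) ∧ the same stub with the extra binder
  `¬ TypeGOrd W p`** (Delbourgo's (G)-ordinary shape, the line's standing ordinarity vocabulary, cf. RED(13♯)).
  Proof of the (G)-ordinary branch: granted modularity the class of `W ⊗ χ_{p*}` has a lattice-optimal globally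
  minimal member `W₀` (`exists_isIsogenous_latticeOptimal`, p606476), starred by the corner clause; a globally
  minimal model `C = u • (W₀ ⊗ χ_{p*})` is isogenous to `W`, so Dokchitser–Dokchitser gives
  `ord_p Δ_min(C) = ord_p Δ_min(W) ∈ {8, 9, 10}` (no `Iₙ*` fibre, `> 4`); but `Δ(C) = u⁻¹² (p*)⁶ Δ(W₀)` with
  `ord_p Δ_min(W₀) ∈ {6, 8, 9, 10}` (additive and potentially good at `p`, `> 4`) forces `12·ord_p(u) ∈ [2, 8]`
  — impossible. So the (G)-ordinary half of the corner — Kodaira (5; III*), (7; IV*), (7; II*) by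
  [DokchitserDokchitser2015, Thm. 3.2 = arXiv Thm. 7] — is EMPTY modulo print, and what remains is the potentially
  supersingular half: (5; IV*), (5; II*), (7; III*), i.e. a starred optimal curve whose rational `p`-isogeny
  FLIPS the Kodaira type ([DokchitserDokchitser2015, Cor. 3.3 = arXiv Cor. 8]; tree cite-only fact
  `gealyKlagsbrun2017_neronScalar_of_additive_potSupersingular`).
* §2 `red57bistarredNonGord_of_optimalUnstarredNonGord` — **the remaining corner is VACUOUS under ONE
  Manin-free law**: «a lattice-optimal (`X₀(N)`-optimal in the lattice sense) globally minimal `W[p]`-reducible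
  twist-minimal curve at `p ∈ {5,7}`, `p² ∣ N(W) > 5·10⁵`, no `Iₙ*` fibre, NOT (G)-ordinary at `p`, is
  UNSTARRED (`ord_p Δ_min ≤ 4`)». Census (cell two-engine tables TWISTCENSUS2 / E20, `N ≤ 5·10⁵`): among the
  2 268 optimal `W[5]`-reducible additive classes the optimal curve is of type II 757 / IV 757 / III 377 /
  III* 377 — NO IV*, NO II*; among the ≈ 490 at `p = 7`: III 176 / IV* 112 / II 112 / II* 43 / IV 43 — NO III*.
  (The starred optimal types that DO occur, (5; III*) and (7; IV*/II*), are exactly the (G)-ordinary ones of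
  §1.) A Stevens-type statement (the `p`-isogenous unstarred partner has the smaller Faltings height by
  `½ log p`, Gealy–Klagsbrun's scalar `α = 1` on the rise); conjecture-shaped HYPOTHESIS, not asserted.
* §3 `red57bistarred_of_dokchitser_of_optimalUnstarredNonGord` (§1 ∘ §2) and the by-name ledger
  `maninPrimeToAdditiveFiveLe_of_kato57_print_dokchitser_of_kp57_of_cores` — **C5 BY NAME ⟸ {F″, ČNS,
  Cremona ≤ 5·10⁵, EdK, EdG, MazurJ, D–D} ∧ KP57 ∧ RED(57♯)[unstarred] ∧ RED(57♯)[bi-starred, not (G)-ordinary]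
  ∧ RED(13♯)** (p617914's `…_of_splitCores` ∘ §1).

HONEST STATUS: conditional-result helpers (`--supports … --as helper`); §1 consumes a cite-only printed fact,
§2 a conjecture-shaped Manin-free hypothesis; nothing is closed. Nothing here proves BSD, Manin's conjecture
or C5.

References: [DokchitserDokchitser2015LocalInvariants] T. Dokchitser, V. Dokchitser, Trans. AMS 367 (2015)
4339–4358, Thm. 5.1 (1), Thm. 3.2, Cor. 3.3, Thm. 5.4 (arXiv:1208.5519 Thm. 19, Thm. 7, Cor. 8, Thm. 22);
[GealyKlagsbrun2017] Thm. 1; [EdixhovenManin1991] Thm. 3, §4; [Stevens1989] §2 and Lemmas (5.2), (5.4);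
[SilvermanATAEC1994] IV Table 4.1; [CesnaviciusNeururerSaha2023] Thm. 1.2.
-/

set_option autoImplicit false
-- the Theorems namespace of this sub repeats the summit name by design (D-0017 nested layout)
set_option linter.dupNamespace false

noncomputable section

open scoped Classical NumberField

namespace Summit.BirchSwinnertonDyer.BirchSwinnertonDyer.Theorems

open WeierstrassCurve IsDedekindDomain IsDedekindDomain.HeightOneSpectrum Rat.HeightOneSpectrum NumberField
  Literature.NumberTheory.EllipticCurves Literature.NumberTheory.EllipticCurves.ModularForms
  Literature.NumberTheory.EllipticCurves.Rank1Residual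
  Literature.NumberTheory.DiophantineGeometry
  Summit.BirchSwinnertonDyer.Rank1Residual.ManinAdditive
  Summit.BirchSwinnertonDyer.Rank1Residual.Additive
  Summit.BirchSwinnertonDyer.BirchSwinnertonDyer.Theses.EdixhovenFibreFiveSeven

/-! ## §1 The (G)-ordinary half of the bi-starred corner is empty (Dokchitser–Dokchitser 2015) -/

/-- **`stub_red57bistarred` ⟸ Dokchitser–Dokchitser 2015 Thm. 5.1 (1) ∧ its potentially-supersingular
half.** `hDD`: the tree's cite-only transcription of [DokchitserDokchitser2015, Thm. 5.1 (1)] (every `ℚ`-isogeny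
preserves `ord_p Δ_min` at a prime of potentially good ORDINARY reduction). `hB'`: the registered stub
`stub_red57bistarred` (= `hB` of `coreRED57sharp_of_cns_of_unstarred_of_bistarred`, p617914, VERBATIM) with ONE
extra binder `¬ TypeGOrd W p` (not (G)-ordinary at `p`; for a starred additive potentially good fibre at
`p ∈ {5,7}` this is Kodaira (5; IV*/II*) or (7; III*), [DokchitserDokchitser2015, Thm. 3.2]). On the
(G)-ordinary branch the corner clause is contradictory: the lattice-optimal `W₀ ∼ W ⊗ χ_{p*}`
(`exists_isIsogenous_latticeOptimal`) is starred by the clause, a globally minimal `C = u • (W₀ ⊗ χ_{p*}) ∼ W`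
has `ord_p Δ_min(C) = ord_p Δ_min(W) ∈ {8,9,10}` by `hDD`, against `Δ(C) = u⁻¹²(p*)⁶Δ(W₀)` with
`ord_p Δ_min(W₀) ∈ {6,8,9,10}`. Conditional result (cite-only fact + open residual); closes nothing.
[cite: DokchitserDokchitser2015LocalInvariants, Thm. 5.1 (1) and Thm. 3.2 (arXiv:1208.5519 Thm. 19 (1), Thm. 7)]
[cite: SilvermanATAEC1994, IV Table 4.1] -/
theorem red57bistarred_of_dokchitser_of_nonGordCorner
    (hDD : dokchitser_padicValInt_minimalDiscriminantInt_eq_of_isogeny_of_potentiallyGoodOrdinary)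
    (hB' : mazur_not_dvd_maninConstant_of_odd → abbesUllmo_not_dvd_maninConstant_of_not_dvd_level →
      cesnavicius_not_two_dvd_maninConstant_of_two_dvd_level → exists_isNewformOf →
      ∀ (W : WeierstrassCurve ℚ) [W.IsElliptic] [W.IsGloballyMinimal] [NeZero (W.conductorNorm ℤ)]
        (D : ModularParametrizationData W (W.conductorNorm ℤ)),
        IsLatticeOptimal D → ∀ (p : ℕ) (hp : p.Prime), (p = 5 ∨ p = 7) → p ^ 2 ∣ W.conductorNorm ℤ →
        ¬ (∃ (W' : WeierstrassCurve ℚ) (q : ℕ), W'.IsElliptic ∧ W'.IsGloballyMinimal ∧ q.Prime ∧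
            q ≠ 2 ∧ q ^ 2 ∣ W.conductorNorm ℤ ∧
            IsIsogenous W (W'.quadraticTwist (((-1 : ℤ) ^ (q / 2) * q : ℤ) : ℚ)) ∧
            ¬ q ^ 2 ∣ W'.conductorNorm ℤ) →
        ¬ (∃ (W' : WeierstrassCurve ℚ) (d : ℤ), W'.IsElliptic ∧ W'.IsGloballyMinimal ∧
            (d = -1 ∨ d = 2 ∨ d = -2) ∧ 2 ^ 2 ∣ W.conductorNorm ℤ ∧
            IsIsogenous W (W'.quadraticTwist (d : ℚ)) ∧ ¬ 2 ^ 2 ∣ W'.conductorNorm ℤ) →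
        ¬ W.HasIrreducibleModPGaloisRep p →
        500000 < W.conductorNorm ℤ →
        p ∣ D.modularDegree →
        (∀ n : ℕ, W.kodairaSymbolAt ((Rat.HeightOneSpectrum.primesEquiv (R := ℤ)).symm ⟨p, hp⟩) ≠
          .Istar n) →
        4 < padicValInt p W.minimalDiscriminantInt →
        ¬ TypeGOrd W p →
        (∀ (W₀ : WeierstrassCurve ℚ) [W₀.IsElliptic] [W₀.IsGloballyMinimal] [NeZero (W₀.conductorNorm ℤ)]
            (D₀ : ModularParametrizationData W₀ (W₀.conductorNorm ℤ)), IsLatticeOptimal D₀ →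
            IsIsogenous (W.quadraticTwist ((((-1 : ℤ) ^ (p / 2) * p : ℤ)) : ℚ)) W₀ →
            4 < padicValInt p W₀.minimalDiscriminantInt) →
        ¬ (p : ℤ) ∣ D.maninConstant) :
    mazur_not_dvd_maninConstant_of_odd → abbesUllmo_not_dvd_maninConstant_of_not_dvd_level →
    cesnavicius_not_two_dvd_maninConstant_of_two_dvd_level → exists_isNewformOf →
    ∀ (W : WeierstrassCurve ℚ) [W.IsElliptic] [W.IsGloballyMinimal] [NeZero (W.conductorNorm ℤ)]
      (D : ModularParametrizationData W (W.conductorNorm ℤ)),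
      IsLatticeOptimal D → ∀ (p : ℕ) (hp : p.Prime), (p = 5 ∨ p = 7) → p ^ 2 ∣ W.conductorNorm ℤ →
      ¬ (∃ (W' : WeierstrassCurve ℚ) (q : ℕ), W'.IsElliptic ∧ W'.IsGloballyMinimal ∧ q.Prime ∧
          q ≠ 2 ∧ q ^ 2 ∣ W.conductorNorm ℤ ∧
          IsIsogenous W (W'.quadraticTwist (((-1 : ℤ) ^ (q / 2) * q : ℤ) : ℚ)) ∧
          ¬ q ^ 2 ∣ W'.conductorNorm ℤ) →
      ¬ (∃ (W' : WeierstrassCurve ℚ) (d : ℤ), W'.IsElliptic ∧ W'.IsGloballyMinimal ∧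
          (d = -1 ∨ d = 2 ∨ d = -2) ∧ 2 ^ 2 ∣ W.conductorNorm ℤ ∧
          IsIsogenous W (W'.quadraticTwist (d : ℚ)) ∧ ¬ 2 ^ 2 ∣ W'.conductorNorm ℤ) →
      ¬ W.HasIrreducibleModPGaloisRep p →
      500000 < W.conductorNorm ℤ →
      p ∣ D.modularDegree →
      (∀ n : ℕ, W.kodairaSymbolAt ((Rat.HeightOneSpectrum.primesEquiv (R := ℤ)).symm ⟨p, hp⟩) ≠
        .Istar n) →
      4 < padicValInt p W.minimalDiscriminantInt →
      (∀ (W₀ : WeierstrassCurve ℚ) [W₀.IsElliptic] [W₀.IsGloballyMinimal] [NeZero (W₀.conductorNorm ℤ)]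
          (D₀ : ModularParametrizationData W₀ (W₀.conductorNorm ℤ)), IsLatticeOptimal D₀ →
          IsIsogenous (W.quadraticTwist ((((-1 : ℤ) ^ (p / 2) * p : ℤ)) : ℚ)) W₀ →
          4 < padicValInt p W₀.minimalDiscriminantInt) →
      ¬ (p : ℤ) ∣ D.maninConstant := by
  intro hM hAU hC hnf W _ _ _ D hD p hp h57 hpN hodd hdy hred hN hdeg hI hv hall
  haveI hpF : Fact p.Prime := ⟨hp⟩
  have h5 : 5 ≤ p := by rcases h57 with rfl | rfl <;> norm_num
  have hp2 : p ≠ 2 := by omega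
  by_cases hG : TypeGOrd W p
  swap
  · exact hB' hM hAU hC hnf W D hD p hp h57 hpN hodd hdy hred hN hdeg hI hv hG hall
  -- the (G)-ordinary branch: the corner clause `hall` is contradictory
  exfalso
  have hd0 : ((((-1 : ℤ) ^ (p / 2) * p : ℤ)) : ℚ) ≠ 0 := by
    push_cast
    exact mul_ne_zero (pow_ne_zero _ (by norm_num)) (by exact_mod_cast hp.ne_zero)
  haveI : (W.quadraticTwist ((((-1 : ℤ) ^ (p / 2) * p : ℤ)) : ℚ)).IsElliptic := W.isElliptic_quadraticTwist hd0
  -- the lattice-optimal member `W₀` of the class of `W ⊗ p*` (granted modularity), starred by the clause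
  obtain ⟨W₀, hE₀, hM₀, hne₀, D₀, hD₀, hiso⟩ :=
    exists_isIsogenous_latticeOptimal hnf (W.quadraticTwist ((((-1 : ℤ) ^ (p / 2) * p : ℤ)) : ℚ))
  have hv₀ : 4 < padicValInt p W₀.minimalDiscriminantInt := hall W₀ D₀ hD₀ hiso
  haveI : (W₀.quadraticTwist ((((-1 : ℤ) ^ (p / 2) * p : ℤ)) : ℚ)).IsElliptic := W₀.isElliptic_quadraticTwist hd0
  haveI : ((W.quadraticTwist ((((-1 : ℤ) ^ (p / 2) * p : ℤ)) : ℚ)).quadraticTwist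
      ((((-1 : ℤ) ^ (p / 2) * p : ℤ)) : ℚ)).IsElliptic :=
    (W.quadraticTwist ((((-1 : ℤ) ^ (p / 2) * p : ℤ)) : ℚ)).isElliptic_quadraticTwist hd0
  -- `W ∼ W₀ ⊗ p*`
  have htw : IsIsogenous W (W₀.quadraticTwist ((((-1 : ℤ) ^ (p / 2) * p : ℤ)) : ℚ)) := by
    obtain ⟨Cq, hCq⟩ := W.exists_variableChange_smul_eq_quadraticTwist_sq hd0
    have h1 : IsIsogenous W ((W.quadraticTwist ((((-1 : ℤ) ^ (p / 2) * p : ℤ)) : ℚ)).quadraticTwist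
        ((((-1 : ℤ) ^ (p / 2) * p : ℤ)) : ℚ)) := by
      rw [quadraticTwist_quadraticTwist, ← sq, ← hCq]
      exact isIsogenous_smul _ _
    exact h1.trans' (hiso.quadraticTwist hd0)
  -- twist-minimality of `W` at `p`: `p² ∣ N(W₀)`, so `W₀` is additive at `p`
  have hpN₀ : p ^ 2 ∣ W₀.conductorNorm ℤ := by
    by_contra h
    exact hodd ⟨W₀, p, hE₀, hM₀, hp, hp2, hpN, htw, h⟩
  have hadd₀ : Addv W₀ p := not_good_and_not_mult_of_sq_dvd_conductorNorm W₀ hpN₀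
  have hadd : Addv W p := not_good_and_not_mult_of_sq_dvd_conductorNorm W hpN
  -- a globally minimal model `C` of `W₀ ⊗ p*`, isogenous to `W`
  obtain ⟨u, hCmin⟩ := hasGlobalMinimalModel_rat_holds (W₀.quadraticTwist ((((-1 : ℤ) ^ (p / 2) * p : ℤ)) : ℚ))
  set C : WeierstrassCurve ℚ := u • W₀.quadraticTwist ((((-1 : ℤ) ^ (p / 2) * p : ℤ)) : ℚ) with hCdef
  haveI : C.IsGloballyMinimal := hCmin
  have hisoWC : IsIsogenous W C :=
    htw.trans' (isIsogenous_smul (W₀.quadraticTwist ((((-1 : ℤ) ^ (p / 2) * p : ℤ)) : ℚ)) u)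
  -- (G)-ordinary ⟹ potentially good ordinary in the tree's sense; Dokchitser–Dokchitser along `W ∼ C`
  have hpo : W.HasPotentiallyGoodOrdinaryReductionAtPrime p := by
    obtain ⟨L, iF, iN, iC, F, hF⟩ := hG
    haveI : NumberField F := NumberField.of_module_finite ℚ F
    obtain ⟨w, hw⟩ := exists_heightOneSpectrum_natCast_mem F p
    exact ⟨F, inferInstance, inferInstance, w, hw, hF w hw⟩
  have hWC : padicValInt p W.minimalDiscriminantInt = padicValInt p C.minimalDiscriminantInt :=
    hDD W C p hp hisoWC hpo
  -- `ord_p Δ_min(W) ∈ {8, 9, 10}`: starred, no `Iₙ*`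
  have hvW : padicValInt p W.minimalDiscriminantInt = 8 ∨ padicValInt p W.minimalDiscriminantInt = 9 ∨
      padicValInt p W.minimalDiscriminantInt = 10 := by
    rcases kodairaSymbolAt_placeOf_cases_of_addv W p h5 hadd with
      ⟨-, h⟩ | ⟨-, h⟩ | ⟨-, h⟩ | ⟨m, h, -⟩ | ⟨-, h⟩ | ⟨-, h⟩ | ⟨-, h⟩
    · omega
    · omega
    · omega
    · exact absurd h (hI m)
    · exact Or.inl h
    · exact Or.inr (Or.inl h)
    · exact Or.inr (Or.inr h)
  -- `ord_p Δ_min(W₀) ∈ {6, 8, 9, 10}`: additive, potentially good (integral `j`, through `C ∼ W`), `> 4`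
  have hjC : 0 ≤ padicValRat p C.j := padicValRat_j_nonneg_of_isIsogenous_of_typeG hG.typeG hisoWC
  have hj₀ : 0 ≤ padicValRat p W₀.j := by
    have h1 : (u • W₀.quadraticTwist ((((-1 : ℤ) ^ (p / 2) * p : ℤ)) : ℚ)).j = W₀.j := by
      rw [variableChange_j, j_quadraticTwist _ hd0]
    have h2 : 0 ≤ padicValRat p (u • W₀.quadraticTwist ((((-1 : ℤ) ^ (p / 2) * p : ℤ)) : ℚ)).j := hjC
    rwa [h1] at h2
  have hv₀' := padicValInt_minimalDiscriminantInt_mem_of_addv_of_padicValRat_j_nonneg W₀ p h5 hadd₀ hj₀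
  -- `Δ(C) = u⁻¹² (p*)⁶ Δ(W₀)`: `ord_p Δ_min(C) = -12·ord_p(u) + 6 + ord_p Δ_min(W₀)`
  have hu0 : (u.u : ℚ) ≠ 0 := u.u.ne_zero
  have hW₀Δ : (W₀.minimalDiscriminantInt : ℚ) ≠ 0 := by exact_mod_cast W₀.minimalDiscriminantInt_ne_zero
  have hdv : padicValRat p ((((-1 : ℤ) ^ (p / 2) * p : ℤ)) : ℚ) = 1 := by
    obtain ⟨-, hd⟩ := pStar_intCast p
    rcases hd with h | h <;> rw [h] <;> push_cast
    · exact_mod_cast padicValRat.self hp.one_lt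
    · rw [padicValRat.neg]; exact_mod_cast padicValRat.self hp.one_lt
  have hΔ : (C.minimalDiscriminantInt : ℚ) =
      (u.u : ℚ)⁻¹ ^ 12 * (((((-1 : ℤ) ^ (p / 2) * p : ℤ)) : ℚ) ^ 6 * W₀.minimalDiscriminantInt) := by
    rw [cast_minimalDiscriminantInt, cast_minimalDiscriminantInt, hCdef, variableChange_Δ, quadraticTwist_Δ,
      Units.val_inv_eq_inv_val]
  have key : (padicValInt p C.minimalDiscriminantInt : ℤ) =
      padicValRat p ((u.u : ℚ)⁻¹ ^ 12 * (((((-1 : ℤ) ^ (p / 2) * p : ℤ)) : ℚ) ^ 6 * W₀.minimalDiscriminantInt)) := by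
    rw [← padicValRat.of_int, hΔ]
  rw [padicValRat.mul (pow_ne_zero _ (inv_ne_zero hu0)) (mul_ne_zero (pow_ne_zero _ hd0) hW₀Δ),
    padicValRat.mul (pow_ne_zero _ hd0) hW₀Δ, padicValRat.pow, padicValRat.pow, padicValRat.inv, hdv,
    padicValRat.of_int] at key
  simp only [mul_neg, mul_one, Nat.cast_ofNat] at key
  omega

/-! ## §2 The potentially supersingular half is vacuous under a Manin-free optimality law -/

/-- **The non-(G)-ordinary bi-starred corner ⟸ «optimal ⟹ unstarred» on the non-(G)-ordinary reducible locus
(Manin-free).** `hU`: for `W` globally minimal with a LATTICE-OPTIMAL conductor-level datum, `p ∈ {5,7}`,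
`p² ∣ N(W) > 5·10⁵`, globally twist-minimal (odd and dyadic clauses), `W[p]` reducible, `p ∣ deg φ`, no `Iₙ*`
fibre at `p`, NOT (G)-ordinary at `p`: `ord_p Δ_min(W) ≤ 4` (Kodaira II/III/IV). Then the corner (which assumes
`4 < ord_p Δ_min(W)`) is empty. Census `N ≤ 5·10⁵`: no optimal `W[5]`-reducible curve of type IV*/II* (0 of
2 268), no optimal `W[7]`-reducible curve of type III* (0 of ≈ 490). `hU` is conjecture-shaped (Stevens-type:
the unstarred `p`-isogenous partner has Faltings height smaller by `½ log p`); NOT asserted. Conditional result.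
[cite: Stevens1989, §2] [cite: GealyKlagsbrun2017, Thm. 1] [cite: DokchitserDokchitser2015LocalInvariants, Cor. 3.3] -/
theorem red57bistarredNonGord_of_optimalUnstarredNonGord
    (hU : exists_isNewformOf →
      ∀ (W : WeierstrassCurve ℚ) [W.IsElliptic] [W.IsGloballyMinimal] [NeZero (W.conductorNorm ℤ)]
        (D : ModularParametrizationData W (W.conductorNorm ℤ)),
        IsLatticeOptimal D → ∀ (p : ℕ) (hp : p.Prime), (p = 5 ∨ p = 7) → p ^ 2 ∣ W.conductorNorm ℤ →
        ¬ (∃ (W' : WeierstrassCurve ℚ) (q : ℕ), W'.IsElliptic ∧ W'.IsGloballyMinimal ∧ q.Prime ∧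
            q ≠ 2 ∧ q ^ 2 ∣ W.conductorNorm ℤ ∧
            IsIsogenous W (W'.quadraticTwist (((-1 : ℤ) ^ (q / 2) * q : ℤ) : ℚ)) ∧
            ¬ q ^ 2 ∣ W'.conductorNorm ℤ) →
        ¬ (∃ (W' : WeierstrassCurve ℚ) (d : ℤ), W'.IsElliptic ∧ W'.IsGloballyMinimal ∧
            (d = -1 ∨ d = 2 ∨ d = -2) ∧ 2 ^ 2 ∣ W.conductorNorm ℤ ∧
            IsIsogenous W (W'.quadraticTwist (d : ℚ)) ∧ ¬ 2 ^ 2 ∣ W'.conductorNorm ℤ) →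
        ¬ W.HasIrreducibleModPGaloisRep p →
        500000 < W.conductorNorm ℤ →
        p ∣ D.modularDegree →
        (∀ n : ℕ, W.kodairaSymbolAt ((Rat.HeightOneSpectrum.primesEquiv (R := ℤ)).symm ⟨p, hp⟩) ≠
          .Istar n) →
        ¬ TypeGOrd W p →
        padicValInt p W.minimalDiscriminantInt ≤ 4) :
    mazur_not_dvd_maninConstant_of_odd → abbesUllmo_not_dvd_maninConstant_of_not_dvd_level →
    cesnavicius_not_two_dvd_maninConstant_of_two_dvd_level → exists_isNewformOf →
    ∀ (W : WeierstrassCurve ℚ) [W.IsElliptic] [W.IsGloballyMinimal] [NeZero (W.conductorNorm ℤ)]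
      (D : ModularParametrizationData W (W.conductorNorm ℤ)),
      IsLatticeOptimal D → ∀ (p : ℕ) (hp : p.Prime), (p = 5 ∨ p = 7) → p ^ 2 ∣ W.conductorNorm ℤ →
      ¬ (∃ (W' : WeierstrassCurve ℚ) (q : ℕ), W'.IsElliptic ∧ W'.IsGloballyMinimal ∧ q.Prime ∧
          q ≠ 2 ∧ q ^ 2 ∣ W.conductorNorm ℤ ∧
          IsIsogenous W (W'.quadraticTwist (((-1 : ℤ) ^ (q / 2) * q : ℤ) : ℚ)) ∧
          ¬ q ^ 2 ∣ W'.conductorNorm ℤ) →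
      ¬ (∃ (W' : WeierstrassCurve ℚ) (d : ℤ), W'.IsElliptic ∧ W'.IsGloballyMinimal ∧
          (d = -1 ∨ d = 2 ∨ d = -2) ∧ 2 ^ 2 ∣ W.conductorNorm ℤ ∧
          IsIsogenous W (W'.quadraticTwist (d : ℚ)) ∧ ¬ 2 ^ 2 ∣ W'.conductorNorm ℤ) →
      ¬ W.HasIrreducibleModPGaloisRep p →
      500000 < W.conductorNorm ℤ →
      p ∣ D.modularDegree →
      (∀ n : ℕ, W.kodairaSymbolAt ((Rat.HeightOneSpectrum.primesEquiv (R := ℤ)).symm ⟨p, hp⟩) ≠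
        .Istar n) →
      4 < padicValInt p W.minimalDiscriminantInt →
      ¬ TypeGOrd W p →
      (∀ (W₀ : WeierstrassCurve ℚ) [W₀.IsElliptic] [W₀.IsGloballyMinimal] [NeZero (W₀.conductorNorm ℤ)]
          (D₀ : ModularParametrizationData W₀ (W₀.conductorNorm ℤ)), IsLatticeOptimal D₀ →
          IsIsogenous (W.quadraticTwist ((((-1 : ℤ) ^ (p / 2) * p : ℤ)) : ℚ)) W₀ →
          4 < padicValInt p W₀.minimalDiscriminantInt) →
      ¬ (p : ℤ) ∣ D.maninConstant := by
  intro _ _ _ hnf W _ _ _ D hD p hp h57 hpN hodd hdy hred hN hdeg hI hv hG _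
  have h := hU hnf W D hD p hp h57 hpN hodd hdy hred hN hdeg hI hG
  omega

/-! ## §3 Compositions: the registered stub and C5 by name -/

/-- **`stub_red57bistarred` ⟸ Dokchitser–Dokchitser 2015 Thm. 5.1 (1) ∧ «optimal ⟹ unstarred» on the
non-(G)-ordinary `W[p]`-reducible locus at `p ∈ {5,7}`** (§1 ∘ §2): the bi-starred corner of RED(57♯) reduced
to ONE cite-only printed fact and ONE Manin-free conjecture-shaped law. Conditional result; closes nothing.
[cite: DokchitserDokchitser2015LocalInvariants, Thm. 5.1 (1)] [cite: Stevens1989, §2] -/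
theorem red57bistarred_of_dokchitser_of_optimalUnstarredNonGord
    (hDD : dokchitser_padicValInt_minimalDiscriminantInt_eq_of_isogeny_of_potentiallyGoodOrdinary)
    (hU : exists_isNewformOf →
      ∀ (W : WeierstrassCurve ℚ) [W.IsElliptic] [W.IsGloballyMinimal] [NeZero (W.conductorNorm ℤ)]
        (D : ModularParametrizationData W (W.conductorNorm ℤ)),
        IsLatticeOptimal D → ∀ (p : ℕ) (hp : p.Prime), (p = 5 ∨ p = 7) → p ^ 2 ∣ W.conductorNorm ℤ →
        ¬ (∃ (W' : WeierstrassCurve ℚ) (q : ℕ), W'.IsElliptic ∧ W'.IsGloballyMinimal ∧ q.Prime ∧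
            q ≠ 2 ∧ q ^ 2 ∣ W.conductorNorm ℤ ∧
            IsIsogenous W (W'.quadraticTwist (((-1 : ℤ) ^ (q / 2) * q : ℤ) : ℚ)) ∧
            ¬ q ^ 2 ∣ W'.conductorNorm ℤ) →
        ¬ (∃ (W' : WeierstrassCurve ℚ) (d : ℤ), W'.IsElliptic ∧ W'.IsGloballyMinimal ∧
            (d = -1 ∨ d = 2 ∨ d = -2) ∧ 2 ^ 2 ∣ W.conductorNorm ℤ ∧
            IsIsogenous W (W'.quadraticTwist (d : ℚ)) ∧ ¬ 2 ^ 2 ∣ W'.conductorNorm ℤ) →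
        ¬ W.HasIrreducibleModPGaloisRep p →
        500000 < W.conductorNorm ℤ →
        p ∣ D.modularDegree →
        (∀ n : ℕ, W.kodairaSymbolAt ((Rat.HeightOneSpectrum.primesEquiv (R := ℤ)).symm ⟨p, hp⟩) ≠
          .Istar n) →
        ¬ TypeGOrd W p →
        padicValInt p W.minimalDiscriminantInt ≤ 4) :
    mazur_not_dvd_maninConstant_of_odd → abbesUllmo_not_dvd_maninConstant_of_not_dvd_level →
    cesnavicius_not_two_dvd_maninConstant_of_two_dvd_level → exists_isNewformOf →
    ∀ (W : WeierstrassCurve ℚ) [W.IsElliptic] [W.IsGloballyMinimal] [NeZero (W.conductorNorm ℤ)]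
      (D : ModularParametrizationData W (W.conductorNorm ℤ)),
      IsLatticeOptimal D → ∀ (p : ℕ) (hp : p.Prime), (p = 5 ∨ p = 7) → p ^ 2 ∣ W.conductorNorm ℤ →
      ¬ (∃ (W' : WeierstrassCurve ℚ) (q : ℕ), W'.IsElliptic ∧ W'.IsGloballyMinimal ∧ q.Prime ∧
          q ≠ 2 ∧ q ^ 2 ∣ W.conductorNorm ℤ ∧
          IsIsogenous W (W'.quadraticTwist (((-1 : ℤ) ^ (q / 2) * q : ℤ) : ℚ)) ∧
          ¬ q ^ 2 ∣ W'.conductorNorm ℤ) →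
      ¬ (∃ (W' : WeierstrassCurve ℚ) (d : ℤ), W'.IsElliptic ∧ W'.IsGloballyMinimal ∧
          (d = -1 ∨ d = 2 ∨ d = -2) ∧ 2 ^ 2 ∣ W.conductorNorm ℤ ∧
          IsIsogenous W (W'.quadraticTwist (d : ℚ)) ∧ ¬ 2 ^ 2 ∣ W'.conductorNorm ℤ) →
      ¬ W.HasIrreducibleModPGaloisRep p →
      500000 < W.conductorNorm ℤ →
      p ∣ D.modularDegree →
      (∀ n : ℕ, W.kodairaSymbolAt ((Rat.HeightOneSpectrum.primesEquiv (R := ℤ)).symm ⟨p, hp⟩) ≠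
        .Istar n) →
      4 < padicValInt p W.minimalDiscriminantInt →
      (∀ (W₀ : WeierstrassCurve ℚ) [W₀.IsElliptic] [W₀.IsGloballyMinimal] [NeZero (W₀.conductorNorm ℤ)]
          (D₀ : ModularParametrizationData W₀ (W₀.conductorNorm ℤ)), IsLatticeOptimal D₀ →
          IsIsogenous (W.quadraticTwist ((((-1 : ℤ) ^ (p / 2) * p : ℤ)) : ℚ)) W₀ →
          4 < padicValInt p W₀.minimalDiscriminantInt) →
      ¬ (p : ℤ) ∣ D.maninConstant :=
  red57bistarred_of_dokchitser_of_nonGordCorner hDD (red57bistarredNonGord_of_optimalUnstarredNonGord hU)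

end Summit.BirchSwinnertonDyer.BirchSwinnertonDyer.Theorems

end
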